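import Literature.MathematicalPhysics.KineticTheory.RegularStationaryState
import HarnessLib

/-!
# Two named facts on laws of point processes: vague compactness of hard-core laws, Laplace-functional uniqueness

Topic `Literature/MathematicalPhysics/KineticTheory` (next to `RegularStationaryState`, which defines the Laplace functional
`PointProcess.laplaceFunctional` and the vague cluster points `PointProcess.IsVagueClusterPoint` these facts speak about).
Requested by crux stmt-AtomisticToContinuum-14135 (`Summits/AtomisticToContinuum/HydrodynamicLimit`, line `FirstLemma`,
file `…Theorems/AntiMazurCoboundariesCorrectorPressureDecayTangentTightness.lean`), where they close the tightness of tangent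
families (`TangentTightness`); both are standard random-measure theory (Kallenberg, *Foundations of Modern Probability*,
2nd ed. 2002, Ch. 12, Ch. 16, App. A2) stated for the tree's locally finite SIMPLE configurations `PointConfig` with the count
σ-algebra `PointConfig.instMeasurableSpace`. NAMED FACTS (unproved here): `HardCoreLawsVaguelyCompact`,
`LaplaceFunctionalDeterminesLaw`. Mathlib's Prokhorov theorem (`isCompact_closure_of_isTightMeasureSet`) is about Borel laws on
(pseudo-)metrisable spaces; the vague topology on `PointConfig` (`Literature/Analysis/FunctionSpaces/PointConfigVagueTopology.lean`)
deliberately comes without metrisability, compactness criteria, or `BorelSpace`, which is why these are recorded as facts.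

What is deliberately NOT here: the general random-measure versions (multiplicities, arbitrary lcscH spaces, tightness of
`ξₙ K` instead of a hard core), metrisability/Polishness of the vague topology (Kallenberg Thm. A2.3 (i)), and the
equivalence of vague convergence in distribution with Laplace-functional convergence (Thm. 16.16) as a statement about
topologies.
-/

noncomputable section

namespace Literature.MathematicalPhysics.KineticTheory

namespace PointProcess

/-- **Vague sequential compactness of laws of hard-core point processes** (NAMED FACT). For `δ > 0`, every sequence of
probability laws on the locally finite simple configurations of `ℝᵈ × ℝᵈ` (position, velocity) carried by `δ`-hard-core
configurations (distinct points have positions `≥ δ` apart, `Literature.Analysis.FluidPDE.IsHardCore δ`) has a vague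
cluster point — along a subsequence the Laplace functionals `E[exp(-∑_{p ∈ ω} f p)]` converge for every continuous
compactly supported `f ≥ 0` (`PointProcess.IsVagueClusterPoint`) — which is again a probability law carried by
`δ`-hard-core configurations. Kallenberg (2002), Lemma 16.15 (a sequence of random measures `ξₙ` on an lcscH space is
tight iff `(ξₙ K)ₙ` is tight for every compact `K`; here `ξₙ K ≤ C_K` surely, by the hard core), Thm. 16.16 (`ξₙ →ᵈ ξ`
iff `E e^{-ξₙ f} → E e^{-ξ f}` for all `f ∈ C_K⁺`) and Thm. A2.3 (ii) (vague relative compactness; the `δ`-hard-core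
counting measures form a vaguely closed set of SIMPLE measures, so the limit is again a law on simple hard-core
configurations). On simple configurations the hard core (or another anti-clustering hypothesis) is needed: with only
bounded local intensities two points may merge in the limit (`δ_{{0, 1/k}}` has Laplace functionals `→ e^{-2f(0)}`, the
transform of the non-simple `2δ₀`).
-- TODO(general form): Kallenberg's Lemma 16.15 / Thm. 16.16 are about random measures with multiplicities on any lcscH
-- space under tightness of `ξₙ K`; only the hard-core simple case in `ℝᵈ × ℝᵈ` is recorded.
[cite: Kallenberg2002, Lemma 16.15, Thm. 16.16 and Thm. A2.3 (ii)] -/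
def HardCoreLawsVaguelyCompact : Prop :=
  ∀ (d : Type) [Fintype d] (δ : ℝ), 0 < δ →
    ∀ P : ℕ → MeasureTheory.Measure
        (Literature.Analysis.FunctionSpaces.PointConfig (EuclideanSpace ℝ d × EuclideanSpace ℝ d)),
      (∀ k, MeasureTheory.IsProbabilityMeasure (P k)) →
      (∀ k, Filter.Eventually (fun ω => Literature.Analysis.FluidPDE.IsHardCore δ ω) (MeasureTheory.ae (P k))) →
      ∃ μ : MeasureTheory.Measure
          (Literature.Analysis.FunctionSpaces.PointConfig (EuclideanSpace ℝ d × EuclideanSpace ℝ d)),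
        MeasureTheory.IsProbabilityMeasure μ ∧
          Filter.Eventually (fun ω => Literature.Analysis.FluidPDE.IsHardCore δ ω) (MeasureTheory.ae μ) ∧
          Literature.MathematicalPhysics.KineticTheory.PointProcess.IsVagueClusterPoint μ P

/-- **The Laplace functional determines the law of a point process** (NAMED FACT). Two finite laws on the locally finite
simple configurations `PointConfig X` of a locally compact second countable Hausdorff space `X` (count σ-algebra) whose
Laplace functionals `E[exp(-∑_{p ∈ ω} f p)]` (`PointProcess.laplaceFunctional`) agree for every continuous, compactly
supported `f ≥ 0` are equal. Kallenberg (2002), Lemma 12.1 ("`ξ =ᵈ η` iff `E e^{-ξf} = E e^{-ηf}` for all `f ∈ C_K⁺`"),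
with Thm. A2.3 (the σ-algebra of counting measures is generated by the counts of bounded sets, i.e. the count σ-algebra).
-- TODO(general form): Kallenberg states it for random measures (with multiplicities) and also with simple point processes
-- determined by their avoidance function (Lemma 12.1 (ii)–(iii)); only part (i) on simple configurations is recorded.
[cite: Kallenberg2002, Lemma 12.1] -/
def LaplaceFunctionalDeterminesLaw : Prop :=
  ∀ (X : Type) [TopologicalSpace X] [T2Space X] [LocallyCompactSpace X] [SecondCountableTopology X]
    [MeasurableSpace X] [BorelSpace X]
    {μ ν : MeasureTheory.Measure (Literature.Analysis.FunctionSpaces.PointConfig X)}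
    [MeasureTheory.IsFiniteMeasure μ] [MeasureTheory.IsFiniteMeasure ν],
    (∀ f : X → ℝ, Continuous f → HasCompactSupport f → (∀ x, 0 ≤ f x) →
      Literature.MathematicalPhysics.KineticTheory.PointProcess.laplaceFunctional μ f =
        Literature.MathematicalPhysics.KineticTheory.PointProcess.laplaceFunctional ν f) → μ = ν

end PointProcess

end Literature.MathematicalPhysics.KineticTheory

end
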